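import Summits.AtomisticToContinuum.Crystallization.Theorems.ExcessDecayLiouvillePhononStabilityCertChainS

/-!
# Near-certificate layer XII-f′: straight chains in machine-integer arithmetic (lead c2, vertex scheme)

Support file for crux `PhononStability` (stmt-AtomisticToContinuum-9333), line `contragredient-window-collapse`.

The rational greedy of `…CertChainS.lean` spends its time normalising fractions; the same greedy in the `×6`
integer coordinates of the generator chart (all of `ζ̂⁰`, `6M₀` are integral there) makes the same kind of choices
with an integer comparison key and runs ~200× faster natively.  Unverified by design (validity is checked by the
certificate).
-/

namespace Summit.AtomisticToContinuum.Crystallization.Theorems.PhononStabilityCWC.Cert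

open Summit.AtomisticToContinuum.Crystallization.Theorems.PhononStabilityNegative
open Summit.AtomisticToContinuum.Crystallization.Theorems.PhononStabilityCWC.FarControlStub

/-! ## Integer version (×6 coordinates; identical choices, machine-integer speed) -/

/-- integer triples -/
abbrev Z3 := ℤ × ℤ × ℤ

/-- `aᵀ (6 M₀) b` -/
def dot6 (a b : Z3) : ℤ :=
  a.1 * (6 * b.1 + 3 * b.2.1) + a.2.1 * (3 * b.1 + 6 * b.2.1) + a.2.2 * (16 * b.2.2)

/-- `6 ζ̂⁰_c` as an integer triple -/
def z6T (c : BondClass) : Z3 := ((6 * zhat0 c 0).floor, (6 * zhat0 c 1).floor, (6 * zhat0 c 2).floor)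

/-- the step classes with their integer directions, in the fixed total order -/
def stepListZ (qs : ℤ) : List (BondClass × Z3) :=
  (((classRange 0 qs).filter fun c => decide (0 < Qint c)).mergeSort stepKeyLE).map fun s => (s, z6T s)

/-- the integer comparison key `A·tt·μd + μn·B` of the greedy cost (`A = ‖rem − v‖²`, `B = ‖v‖²‖t‖² − ⟪v,t⟫²`,
all in the `×6` scaling; same ORDER as the rational cost for `tt > 0`) -/
def keyZ (μn μd tt : ℤ) (rem t v : Z3) : ℤ :=
  let d : Z3 := (rem.1 - v.1, rem.2.1 - v.2.1, rem.2.2 - v.2.2)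
  let vt := dot6 v t
  dot6 d d * tt * μd + μn * (dot6 v v * tt - vt * vt)

/-- the best step from sublattice `cur` -/
def bestStepZ (steps : List (BondClass × Z3)) (μn μd tt : ℤ) (cur : Fin 2) (rem t : Z3) : Option (BondClass × Z3) :=
  steps.foldl (fun best s =>
    if s.1.1 = cur then
      match best with
      | none => some s
      | some b => if keyZ μn μd tt rem t s.2 < keyZ μn μd tt rem t b.2 then some s else some b
    else best) none

/-- the greedy chain with fuel -/
def chainGreedyZ (steps : List (BondClass × Z3)) (μn μd tt : ℤ) (t : Z3) : ℕ → Fin 2 → Fin 2 → Z3 → List BondClass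
  | 0, _, _, _ => []
  | fuel + 1, cur, tgtSub, rem =>
    if cur = tgtSub ∧ rem.1 = 0 ∧ rem.2.1 = 0 ∧ rem.2.2 = 0 then []
    else match bestStepZ steps μn μd tt cur rem t with
      | none => []
      | some s => s.1 :: chainGreedyZ steps μn μd tt t fuel s.1.2.1 tgtSub (rem.1 - s.2.1, rem.2.1 - s.2.2.1, rem.2.2 - s.2.2.2)

/-- **the straight chain of a class, integer arithmetic** (straightness weight `μn/μd`) -/
def chainSZOf (steps : List (BondClass × Z3)) (μn μd : ℤ) (c : BondClass) : List BondClass :=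
  let t := z6T c
  chainGreedyZ steps μn μd (dot6 t t) t 64 c.1 c.2.1 t

/-- Anchor of this support file (registered stub of the line skeleton, lead c2): no steps, no chain. -/
theorem stub_certChainSZ : chainGreedyZ [] 0 1 0 (0, 0, 0) 0 0 0 (0, 0, 0) = [] := by
  rfl

end Summit.AtomisticToContinuum.Crystallization.Theorems.PhononStabilityCWC.Cert
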